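import Mathlib
import Summits.Ventures.PercRepro2.HCov
import Summits.Ventures.PercRepro2.PocketTransport
import Summits.Ventures.PercRepro2.RootLeafUPocketGraph
import Summits.Ventures.PercRepro2.RootLeafUPocketShare
import Summits.Ventures.PercRepro2.RootLeafUPocketFacts
import Summits.Ventures.PercRepro2.RootLeafUPocketAddEdge

/-!
# Adding one edge outside a pocket, II: an arbitrary outside edge `x–y`, and the edge `u–a₂`
(blind cell PercRepro2, p4 g22; S3 (G4-u), the «limit» route of proofs/P4-G19-OUTSIDE.md §2 for `(P-24)`; no definitions)

RootLeafUPocketAddEdge with the new edge `none` joining two outside vertices `x, y ∉ P` (`touches_option_xy`,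
`hP_option_xy`, `prob_inn_option_xy`, `prob_off_option_xy`), and the outside atoms for the edge `u–a₂` of weight
`q` (`prob_off_option_atom_ua`, `prob_off_option_PD_ua`, `prob_off_option_T_ua`): the outside law is
`x = (0, 0, q, 0, 1 − q)`, `D₀ = 1 − q`, `t₀ = 0`.
-/

namespace Summit.Ventures.PercRepro2

open UnionCluster CovForm

namespace RootLeafU

namespace PocketAddEdge

variable {V : Type*} {E : Type*}

section TouchesXY

variable {ends : E → Sym2 V} {P : Set V} {x y : V}

/-- The new edge `none` (ends `x, y ∉ P`) does not touch the pocket; the old edges touch it as before. -/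
lemma touches_option_xy (hx : x ∉ P) (hy : y ∉ P) (o : Option E) :
    o ∈ touches (fun o : Option E => o.elim s(x, y) ends) P ↔ ∃ e, o = some e ∧ e ∈ touches ends P := by
  cases o with
  | none =>
    simp only [touches, Set.mem_setOf_eq, Option.elim, reduceCtorEq, false_and, exists_false, iff_false]
    rintro ⟨z, hz, w, hzw⟩
    rw [Sym2.eq_iff] at hzw
    rcases hzw with ⟨h1, _⟩ | ⟨_, h2⟩
    · exact hx (h1 ▸ hz)
    · exact hy (h2 ▸ hz)
  | some e =>
    simp only [touches, Set.mem_setOf_eq, Option.elim, Option.some.injEq, exists_eq_left']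

/-- The augmented incidence map still has the pocket property (terminals `u, a₂, c`). -/
lemma hP_option_xy {u a₂ c : V} (hP : ∀ e y z, ends e = s(y, z) → y ∈ P → z ∈ P ∨ z = u ∨ z = a₂ ∨ z = c)
    (hx : x ∉ P) (hy : y ∉ P) :
    ∀ e y' z, (fun o : Option E => o.elim s(x, y) ends) e = s(y', z) → y' ∈ P → z ∈ P ∨ z = u ∨ z = a₂ ∨ z = c := by
  intro e y' z he hy'
  cases e with
  | none =>
    simp only [Option.elim] at he
    rw [Sym2.eq_iff] at he
    rcases he with ⟨h1, _⟩ | ⟨_, h2⟩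
    · exact absurd (h1 ▸ hy') hx
    · exact absurd (h2 ▸ hy') hy
  | some e => exact hP e y' z he hy'

end TouchesXY

section TransferXY

variable [Fintype E] [DecidableEq E] [Fintype V] [DecidableEq V] {R : Type*} [Field R] [LinearOrder R] [IsStrictOrderedRing R]
variable {ends : E → Sym2 V} {P : Set V} {x y u a₂ c b : V} {inn : Config E → Config E}

omit [LinearOrder R] [IsStrictOrderedRing R] in
/-- **Pocket transfer** for the new edge `x–y`. -/
theorem prob_inn_option_xy (p : E → R) (r : R) (hx : x ∉ P) (hy : y ∉ P)
    (hinn : (∀ ω e, e ∈ touches ends P → inn ω e = ω e) ∧ (∀ ω e, e ∉ touches ends P → inn ω e = false))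
    (inn' : Config (Option E) → Config (Option E))
    (hinn' : (∀ ω e, e ∈ touches (fun o : Option E => o.elim s(x, y) ends) P → inn' ω e = ω e) ∧
      (∀ ω e, e ∉ touches (fun o : Option E => o.elim s(x, y) ends) P → inn' ω e = false))
    (v : Bool × Bool × Bool × Bool × Bool × Bool) :
    prob (fun o : Option E => o.elim r (PocketConn.zeroOn (by classical exact (touches ends P)ᶜ.toFinset) p)) {ω' : Config (Option E) | inn' ω' ∈ {ω'' : Config (Option E) | (decide (Conn (fun o : Option E => o.elim s(x, y) ends) ω'' u a₂), decide (Conn (fun o : Option E => o.elim s(x, y) ends) ω'' u c), decide (Conn (fun o : Option E => o.elim s(x, y) ends) ω'' u b), decide (Conn (fun o : Option E => o.elim s(x, y) ends) ω'' a₂ c), decide (Conn (fun o : Option E => o.elim s(x, y) ends) ω'' a₂ b), decide (Conn (fun o : Option E => o.elim s(x, y) ends) ω'' c b)) = v}} =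
    prob p {ω : Config E | inn ω ∈ {ω'' : Config E | (decide (Conn ends ω'' u a₂), decide (Conn ends ω'' u c), decide (Conn ends ω'' u b), decide (Conn ends ω'' a₂ c), decide (Conn ends ω'' a₂ b), decide (Conn ends ω'' c b)) = v}} := by
  classical
  have h0 : ∀ ω' : Config (Option E), inn' ω' none = false := fun ω' =>
    hinn'.2 ω' none (by rw [touches_option_xy hx hy]; rintro ⟨e, he, _⟩; cases he)
  have hsome : ∀ ω' : Config (Option E), (fun e => inn' ω' (some e)) = inn (fun e => ω' (some e)) := by
    intro ω'
    funext e
    by_cases he : e ∈ touches ends P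
    · rw [hinn'.1 ω' (some e) ((touches_option_xy hx hy (some e)).2 ⟨e, rfl, he⟩), hinn.1 _ e he]
    · rw [hinn'.2 ω' (some e) (fun h => he (by obtain ⟨e', he', h'⟩ := (touches_option_xy hx hy (some e)).1 h; cases he'; exact h')), hinn.2 _ e he]
  have hset : {ω' : Config (Option E) | inn' ω' ∈ {ω'' : Config (Option E) | (decide (Conn (fun o : Option E => o.elim s(x, y) ends) ω'' u a₂), decide (Conn (fun o : Option E => o.elim s(x, y) ends) ω'' u c), decide (Conn (fun o : Option E => o.elim s(x, y) ends) ω'' u b), decide (Conn (fun o : Option E => o.elim s(x, y) ends) ω'' a₂ c), decide (Conn (fun o : Option E => o.elim s(x, y) ends) ω'' a₂ b), decide (Conn (fun o : Option E => o.elim s(x, y) ends) ω'' c b)) = v}} =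
      {ω' : Config (Option E) | (fun e => ω' (some e)) ∈ {ω : Config E | inn ω ∈ {ω'' : Config E | (decide (Conn ends ω'' u a₂), decide (Conn ends ω'' u c), decide (Conn ends ω'' u b), decide (Conn ends ω'' a₂ c), decide (Conn ends ω'' a₂ b), decide (Conn ends ω'' c b)) = v}}} := by
    ext ω'
    simp only [Set.mem_setOf_eq]
    simp only [conn_option_of_none_false ends x y _ (h0 ω'), hsome ω']
  rw [hset, prob_option_some]
  have hz : (fun e => (fun o : Option E => o.elim r (PocketConn.zeroOn (touches ends P)ᶜ.toFinset p)) (some e)) =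
      PocketConn.zeroOn (touches ends P)ᶜ.toFinset p := rfl
  rw [hz, PocketFacts.prob_inn_eq _ hinn, PocketFacts.prob_inn_eq _ hinn]
  congr 1
  funext e
  simp only [PocketConn.zeroOn]
  split_ifs <;> rfl

omit [LinearOrder R] [IsStrictOrderedRing R] in
/-- **Outside transfer** for the new edge `x–y`. -/
theorem prob_off_option_xy (p : E → R) (r : R) (hx : x ∉ P) (hy : y ∉ P)
    (off' : Config (Option E) → Config (Option E))
    (hoff' : (∀ ω e, e ∈ touches (fun o : Option E => o.elim s(x, y) ends) P → off' ω e = false) ∧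
      (∀ ω e, e ∉ touches (fun o : Option E => o.elim s(x, y) ends) P → off' ω e = ω e))
    (Z : Set (Config (Option E))) :
    prob (fun o : Option E => o.elim r (PocketConn.zeroOn (by classical exact (touches ends P)ᶜ.toFinset) p)) {ω' : Config (Option E) | off' ω' ∈ Z} =
    prob (fun o : Option E => o.elim r p) {ω' : Config (Option E) | (fun o : Option E => o.elim (ω' none) (fun _ => false)) ∈ Z} := by
  classical
  have hzero : (fun o : Option E => o.elim r (PocketConn.zeroOn (touches ends P)ᶜ.toFinset p)) =
      PocketConn.zeroOn (((touches ends P)ᶜ.toFinset).map Function.Embedding.some) (fun o : Option E => o.elim r p) := by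
    funext o
    cases o with
    | none => simp [PocketConn.zeroOn, Option.elim]
    | some e =>
      simp only [PocketConn.zeroOn, Option.elim, Finset.mem_map, Function.Embedding.some_apply,
        Option.some.injEq, exists_eq_right]
  rw [hzero, PocketConn.prob_zeroOn]
  congr 1
  ext ω'
  simp only [Set.mem_setOf_eq]
  have hclose : off' (PocketConn.closeOn (((touches ends P)ᶜ.toFinset).map Function.Embedding.some) ω') =
      (fun o : Option E => o.elim (ω' none) (fun _ => false)) := by
    funext o
    cases o with
    | none =>
      rw [hoff'.2 _ none (by rw [touches_option_xy hx hy]; rintro ⟨e, he, _⟩; cases he)]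
      simp [PocketConn.closeOn, Option.elim]
    | some e =>
      by_cases he : e ∈ touches ends P
      · rw [hoff'.1 _ (some e) ((touches_option_xy hx hy (some e)).2 ⟨e, rfl, he⟩)]
        rfl
      · rw [hoff'.2 _ (some e) (fun h => he (by obtain ⟨e', he', h'⟩ := (touches_option_xy hx hy (some e)).1 h; cases he'; exact h'))]
        simp [PocketConn.closeOn, Option.elim, he]
  rw [hclose]

end TransferXY

section EdgeUA

variable [Fintype E] [DecidableEq E] [Fintype V] [DecidableEq V] {R : Type*} [CommRing R]
variable {ends : E → Sym2 V} {P : Set V} {u a₂ c : V}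

omit [DecidableEq E] in
/-- The pattern of the single-edge configuration `u–a₂` on the three terminals (pairwise distinct). -/
lemma single_edge_pattern_ua (hua : u ≠ a₂) (hac : a₂ ≠ c) (huc : u ≠ c) (b : Bool) :
    (decide (Conn (fun o : Option E => o.elim s(u, a₂) ends) (fun o : Option E => o.elim b (fun _ => false)) u a₂),
     decide (Conn (fun o : Option E => o.elim s(u, a₂) ends) (fun o : Option E => o.elim b (fun _ => false)) u c),
     decide (Conn (fun o : Option E => o.elim s(u, a₂) ends) (fun o : Option E => o.elim b (fun _ => false)) a₂ c)) = (b, false, false) := by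
  cases b <;> simp [conn_single_edge, hua, hac, huc, hua.symm, hac.symm, huc.symm]

end EdgeUA

section EdgeUAProb

variable [Fintype E] [DecidableEq E] [Fintype V] [DecidableEq V] {R : Type*} [Field R] [LinearOrder R] [IsStrictOrderedRing R]
variable {ends : E → Sym2 V} {P : Set V} {u a₂ c : V}

omit [LinearOrder R] [IsStrictOrderedRing R] in
/-- The outside atom of the augmented instance with the edge `u–a₂`: `q` for the pattern `u ~ a₂`, `1 − q` for the trivial pattern, `0` otherwise. -/
theorem prob_off_option_atom_ua (p : E → R) (q : R) (hu : u ∉ P) (ha : a₂ ∉ P)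
    (hua : u ≠ a₂) (hac : a₂ ≠ c) (huc : u ≠ c)
    (off' : Config (Option E) → Config (Option E))
    (hoff' : (∀ ω e, e ∈ touches (fun o : Option E => o.elim s(u, a₂) ends) P → off' ω e = false) ∧
      (∀ ω e, e ∉ touches (fun o : Option E => o.elim s(u, a₂) ends) P → off' ω e = ω e))
    (v : Bool × Bool × Bool) :
    prob (fun o : Option E => o.elim q (PocketConn.zeroOn (by classical exact (touches ends P)ᶜ.toFinset) p)) {ω' : Config (Option E) | off' ω' ∈ {ω'' : Config (Option E) | (decide (Conn (fun o : Option E => o.elim s(u, a₂) ends) ω'' u a₂), decide (Conn (fun o : Option E => o.elim s(u, a₂) ends) ω'' u c), decide (Conn (fun o : Option E => o.elim s(u, a₂) ends) ω'' a₂ c)) = v}} =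
    if v.2.1 = false ∧ v.2.2 = false then edgeFactor q v.1 else 0 := by
  classical
  rw [prob_off_option_xy p q hu ha off' hoff']
  obtain ⟨v1, v2, v3⟩ := v
  by_cases h : v2 = false ∧ v3 = false
  · obtain ⟨rfl, rfl⟩ := h
    have hset : {ω' : Config (Option E) | (fun o : Option E => o.elim (ω' none) (fun _ => false)) ∈ {ω'' : Config (Option E) | (decide (Conn (fun o : Option E => o.elim s(u, a₂) ends) ω'' u a₂), decide (Conn (fun o : Option E => o.elim s(u, a₂) ends) ω'' u c), decide (Conn (fun o : Option E => o.elim s(u, a₂) ends) ω'' a₂ c)) = (v1, false, false)}} = {ω' : Config (Option E) | ω' none = v1} := by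
      ext ω'
      simp only [Set.mem_setOf_eq, single_edge_pattern_ua hua hac huc]
      simp only [Prod.mk.injEq, and_true]
    rw [hset, prob_option_none]
    simp only [Option.elim, and_self, if_true]
  · have hset : {ω' : Config (Option E) | (fun o : Option E => o.elim (ω' none) (fun _ => false)) ∈ {ω'' : Config (Option E) | (decide (Conn (fun o : Option E => o.elim s(u, a₂) ends) ω'' u a₂), decide (Conn (fun o : Option E => o.elim s(u, a₂) ends) ω'' u c), decide (Conn (fun o : Option E => o.elim s(u, a₂) ends) ω'' a₂ c)) = (v1, v2, v3)}} = ∅ := by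
      ext ω'
      simp only [Set.mem_setOf_eq, single_edge_pattern_ua hua hac huc]
      simp only [Prod.mk.injEq, Set.mem_empty_iff_false, iff_false]
      rintro ⟨_, h2, h3⟩
      exact h ⟨h2.symm, h3.symm⟩
    rw [hset, prob_empty]
    simp only [h, if_false]

omit [LinearOrder R] [IsStrictOrderedRing R] in
/-- `D₀` of the augmented instance with the edge `u–a₂`: the new edge closed, `1 − q`. -/
theorem prob_off_option_PD_ua (p : E → R) (q : R) (hu : u ∉ P) (ha : a₂ ∉ P)
    (hua : u ≠ a₂) (hac : a₂ ≠ c) (huc : u ≠ c)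
    (off' : Config (Option E) → Config (Option E))
    (hoff' : (∀ ω e, e ∈ touches (fun o : Option E => o.elim s(u, a₂) ends) P → off' ω e = false) ∧
      (∀ ω e, e ∉ touches (fun o : Option E => o.elim s(u, a₂) ends) P → off' ω e = ω e)) :
    prob (fun o : Option E => o.elim q (PocketConn.zeroOn (by classical exact (touches ends P)ᶜ.toFinset) p)) {ω' : Config (Option E) | off' ω' ∈ PDEvent (fun o : Option E => o.elim s(u, a₂) ends) u a₂ c} = 1 - q := by
  classical
  rw [prob_off_option_xy p q hu ha off' hoff']
  have hset : {ω' : Config (Option E) | (fun o : Option E => o.elim (ω' none) (fun _ => false)) ∈ PDEvent (fun o : Option E => o.elim s(u, a₂) ends) u a₂ c} = {ω' : Config (Option E) | ω' none = false} := by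
    ext ω'
    simp only [Set.mem_setOf_eq, PDEvent, Dtilde, UnionCluster.inU, Set.mem_inter_iff, Set.mem_compl_iff, Set.mem_union, mem_connEvent]
    cases hb : ω' none <;> simp [conn_single_edge, hua, hua.symm, hac.symm, huc.symm]
  rw [hset, prob_option_none]
  rfl

omit [LinearOrder R] [IsStrictOrderedRing R] in
/-- `t₀` of the augmented instance with the edge `u–a₂`: `a₂ ~ c` outside is impossible, `0`. -/
theorem prob_off_option_T_ua (p : E → R) (q : R) (hu : u ∉ P) (ha : a₂ ∉ P)
    (hua : u ≠ a₂) (hac : a₂ ≠ c) (huc : u ≠ c)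
    (off' : Config (Option E) → Config (Option E))
    (hoff' : (∀ ω e, e ∈ touches (fun o : Option E => o.elim s(u, a₂) ends) P → off' ω e = false) ∧
      (∀ ω e, e ∉ touches (fun o : Option E => o.elim s(u, a₂) ends) P → off' ω e = ω e)) :
    prob (fun o : Option E => o.elim q (PocketConn.zeroOn (by classical exact (touches ends P)ᶜ.toFinset) p)) {ω' : Config (Option E) | off' ω' ∈ TEvent (fun o : Option E => o.elim s(u, a₂) ends) u a₂ c} = 0 := by
  classical
  rw [prob_off_option_xy p q hu ha off' hoff']
  have hset : {ω' : Config (Option E) | (fun o : Option E => o.elim (ω' none) (fun _ => false)) ∈ TEvent (fun o : Option E => o.elim s(u, a₂) ends) u a₂ c} = ∅ := by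
    ext ω'
    simp only [Set.mem_setOf_eq, TEvent, Set.mem_inter_iff, Set.mem_compl_iff, mem_connEvent, Set.mem_empty_iff_false, iff_false]
    cases hb : ω' none <;> simp [conn_single_edge, hua, hac, hua.symm, hac.symm, huc.symm]
  rw [hset, prob_empty]

end EdgeUAProb

end PocketAddEdge

end RootLeafU

end Summit.Ventures.PercRepro2
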